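import Summits.KontsevichZagierPeriods.KontsevichZagierPeriods.Theses.FermatIsogeny
import Summits.KontsevichZagierPeriods.KontsevichZagierPeriods.Theorems.FermatIsogenyBetaLinearSectorQuartersBridges
import Summits.KontsevichZagierPeriods.KontsevichZagierPeriods.Theorems.FermatIsogenyBetaLinearSectorSixthsStubSexticBeta
import Summits.KontsevichZagierPeriods.KontsevichZagierPeriods.Theorems.FermatIsogenyBetaLinearSectorSixthsStubSexticHalf
import Summits.KontsevichZagierPeriods.KontsevichZagierPeriods.Theorems.FermatIsogenyBetaLinearSectorSixthsStubSexticAffine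
import Summits.KontsevichZagierPeriods.KontsevichZagierPeriods.Theorems.FermatIsogenyBetaLinearSectorSixthsStubAffineEvenLorentz
import Summits.KontsevichZagierPeriods.KontsevichZagierPeriods.Theorems.FermatIsogenyBetaLinearSectorSixthsStubArctanUnitLorentz

/-!
# `BetaLinearSector` at level `6` — Euler's reflection at `1/6` inside the calculus

Support file of crux `BetaLinearSector` (stmt-KontsevichZagierPeriods-3897, route FermatIsogeny).  The `π`-class of the level-`6` rung contains the
Beta cell `β(1/6,5/6)` (value `π/sin(π/6) = 2π`), related to `β(1/2,1/2)` (value `π`) only through Euler's reflection formula.  This file realises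
the instance `a = 1/6` of crux `EulerReflectionRational` (route CompiledSubstitutions, stmt-3383) in its VERBATIM shape (registered anchor
`eulerReflectionRational_one_sixth`), and `a = 5/6` by one more reflection: `[(0,1), sin(π/6)·x^{-5/6}(1-x)^{-1/6}] ∼ [closed unit disc, 1]`.
Chain (five registered stubs of the line, each ONE or TWO moves): the sextic Fermat parametrisation `x = w⁶/(w⁶+(1−w)⁶)` makes the cell rational,
`[(0,1), 6(1−w)⁴/Q₆]`, `Q₆ = w⁶ + (1−w)⁶` (`stub_sexticRational_equivalent_beta`); fold at `1/2` (`stub_sexticRational_equivalent_half`); the affine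
move `v = 1 − 2w` gives `[(0,1), 12(1+6v²+v⁴)/((1+v²)(1+14v²+v⁴))]` since `8(a⁴+b⁴) = 1+6v²+v⁴`, `32(a⁶+b⁶) = (1+v²)(1+14v²+v⁴)` for
`a, b = (1∓v)/2` (`stub_sexticHalf_equivalent_affine`); PARTIAL FRACTIONS `12(1+6v²+v⁴)/((1+v²)(1+14v²+v⁴)) = 4/(1+v²) + 8(1+v²)/(1+14v²+v⁴)`
(rule 1b); each summand is ONE arctangent substitution away from the half-line Lorentzian `[(0,∞), 2/(1+u²)]` — `u = 2v/(1−v²)`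
(`stub_arctanUnit_equivalent_lorentz`) and `u = 4v/(1−v²)`, `(1−v²)² + 16v² = 1+14v²+v⁴` (`stub_affineEven_equivalent_lorentz`); and the
Lorentzian is the disc (`Quarters.stub_lorentzHalfLine_equivalent_disc`, landed).  So `[β(1/6,5/6)] ∼ 2·[(0,∞), 2/(1+u²)] ∼ 2·[π]`.
References: M. Kontsevich, D. Zagier, *Periods* (2001), §1.2; G. E. Andrews, R. Askey, R. Roy, *Special Functions* (1999), Thm 1.2.1.
-/

noncomputable section

namespace Summit.KontsevichZagierPeriods.FermatIsogeny.BetaLinearSector.Sixths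

open MeasureTheory Set Literature.NumberTheory.Transcendental Literature.NumberTheory.Transcendental.KZ
open MvPolynomial (X C)
open Literature.ModelTheory.ExponentialFields (IsSemialgebraic)
open Summit.KontsevichZagierPeriods.KontsevichZagierPeriods.Theorems.GKZLevelThree (exists_rep_Ioo₁ isSemialgebraicFunOn_ratFun₁)
open Summit.KontsevichZagierPeriods.KontsevichZagierPeriods.BetaCancellationNegative (isAlgebraic_sin_pi_mul_rat)
open Summit.KontsevichZagierPeriods.FermatIsogeny.BetaLinearSector.Quarters (exists_lorentzHalfLineRep stub_lorentzHalfLine_equivalent_disc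
  isAlgebraic_one_half)

/-! ## The rational representations of the chain exist -/

/-- `1 + 14v² + v⁴ > 0`. [folklore] -/
theorem evenDen_pos (v : ℝ) : 0 < 1 + 14 * v ^ 2 + v ^ 4 := by positivity

/-- A bounded `ℚ`-rational representation on `(a,b)` exists when the denominator does not vanish on `[a,b]`. [cite: KontsevichZagier2001, §1.1] -/
theorem exists_ratRep {a b : ℚ} (p q : MvPolynomial (Fin 1) ℚ) (f : ℝ → ℝ) (hq : ∀ x : Fin 1 → ℝ, MvPolynomial.aeval x q ≠ 0)
    (hf : ∀ x : Fin 1 → ℝ, f (x 0) = MvPolynomial.aeval x p / MvPolynomial.aeval x q) (hfc : Continuous f) :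
    ∃ r : IntegralRep 1, r.domain = {x : Fin 1 → ℝ | (a:ℝ) < x 0 ∧ x 0 < b} ∧ r.integrand = fun x => f (x 0) :=
  exists_rep_Ioo₁ (isAlgebraic_algebraMap a) (isAlgebraic_algebraMap b) f hfc.continuousOn
    (isSemialgebraicFunOn_ratFun₁ ((KZ.isSemialgebraic_setOf_const_lt_apply (isAlgebraic_algebraMap a) 0).inter
      (KZ.isSemialgebraic_setOf_apply_lt_const (isAlgebraic_algebraMap b) 0)) p q f (fun x _ => hq x) (fun x _ => hf x))

/-! ## Euler's reflection at `1/6` -/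

/-- **`B(1/6,5/6) = 2π` inside the rules**: every Beta cell `[(0,1), x^{-5/6}(1-x)^{-1/6}]` is KZ-equivalent to `2·[π]` (`KZ.piRep`), by the five
stubs of the chain, partial fractions, and the landed `Quarters.stub_lorentzHalfLine_equivalent_disc`. [cite: KontsevichZagier2001, §1.2]
[cite: AndrewsAskeyRoy1999, Thm 1.2.1] -/
theorem betaSixth_equivalent_two_piRep (h2 : IsAlgebraic ℚ (2:ℝ)) (β : IntegralRep 1) (hβd : β.domain = {x | x 0 ∈ Set.Ioo (0:ℝ) 1})
    (hβi : EqOn β.integrand (fun x => (x 0) ^ (-(5:ℝ) / 6) * (1 - x 0) ^ (-(1:ℝ) / 6)) β.domain) :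
    Equivalent β (piRep.constMul 2 h2) := by
  -- the rational representations
  obtain ⟨W, hWd, hWi⟩ := exists_ratRep (a := 0) (b := 1) (C 6 * (1 - X 0) ^ 4) (X 0 ^ 6 + (1 - X 0) ^ 6)
    (fun w => 6 * (1 - w) ^ 4 / (w ^ 6 + (1 - w) ^ 6)) (fun x => by simpa using (sexticHalf_den_pos (x 0)).ne') (fun x => by simp)
    ((by fun_prop : Continuous fun w : ℝ => 6 * (1 - w) ^ 4).div (by fun_prop) fun w => (sexticHalf_den_pos w).ne')
  obtain ⟨H, hHd, hHi⟩ := exists_ratRep (a := 0) (b := 1 / 2) (C 6 * ((1 - X 0) ^ 4 + X 0 ^ 4)) (X 0 ^ 6 + (1 - X 0) ^ 6)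
    (fun w => 6 * ((1 - w) ^ 4 + w ^ 4) / (w ^ 6 + (1 - w) ^ 6)) (fun x => by simpa using (sexticHalf_den_pos (x 0)).ne') (fun x => by simp)
    ((by fun_prop : Continuous fun w : ℝ => 6 * ((1 - w) ^ 4 + w ^ 4)).div (by fun_prop) fun w => (sexticHalf_den_pos w).ne')
  obtain ⟨V, hVd, hVi⟩ := exists_ratRep (a := 0) (b := 1) (C 12 * (1 + C 6 * X 0 ^ 2 + X 0 ^ 4)) ((1 + X 0 ^ 2) * (1 + C 14 * X 0 ^ 2 + X 0 ^ 4))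
    (fun v => 12 * (1 + 6 * v ^ 2 + v ^ 4) / ((1 + v ^ 2) * (1 + 14 * v ^ 2 + v ^ 4)))
    (fun x => by simpa using mul_ne_zero (by positivity : (1 + (x 0) ^ 2) ≠ 0) (evenDen_pos (x 0)).ne') (fun x => by simp)
    ((by fun_prop : Continuous fun v : ℝ => 12 * (1 + 6 * v ^ 2 + v ^ 4)).div (by fun_prop)
      fun v => mul_ne_zero (by positivity) (evenDen_pos v).ne')
  obtain ⟨V₁, hV₁d, hV₁i⟩ := exists_ratRep (a := 0) (b := 1) (C 4) (1 + X 0 ^ 2) (fun v => 4 / (1 + v ^ 2))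
    (fun x => by simp; positivity) (fun x => by simp) (continuous_const.div (by fun_prop) fun v => by positivity)
  obtain ⟨V₂, hV₂d, hV₂i⟩ := exists_ratRep (a := 0) (b := 1) (C 8 * (1 + X 0 ^ 2)) (1 + C 14 * X 0 ^ 2 + X 0 ^ 4)
    (fun v => 8 * (1 + v ^ 2) / (1 + 14 * v ^ 2 + v ^ 4)) (fun x => by simpa using (evenDen_pos (x 0)).ne') (fun x => by simp)
    ((by fun_prop : Continuous fun v : ℝ => 8 * (1 + v ^ 2)).div (by fun_prop) fun v => (evenDen_pos v).ne')
  obtain ⟨L, hLd, hLi⟩ := exists_lorentzHalfLineRep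
  have hunit : ∀ {r : IntegralRep 1}, r.domain = {x : Fin 1 → ℝ | ((0:ℚ):ℝ) < x 0 ∧ x 0 < (1:ℚ)} → r.domain = {x | x 0 ∈ Set.Ioo (0:ℝ) 1} := by
    intro r h
    rw [h]
    ext x
    simp [mem_Ioo]
  have hWd' := hunit hWd
  have hVd' := hunit hVd
  have hV₁d' := hunit hV₁d
  have hV₂d' := hunit hV₂d
  have hHd' : H.domain = {x | 0 < x 0 ∧ x 0 < 1 / 2} := by rw [hHd]; ext x; simp
  -- the chain of stubs
  have e₁ : Equivalent W β := stub_sexticRational_equivalent_beta W β hWd' (fun x _ => by rw [hWi]) hβd hβi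
  have e₂ : Equivalent W H := stub_sexticRational_equivalent_half W H hWd' (fun x _ => by rw [hWi]) hHd' (fun x _ => by rw [hHi])
  have e₃ : Equivalent H V := stub_sexticHalf_equivalent_affine H V hHd' (fun x _ => by rw [hHi]) hVd' (fun x _ => by rw [hVi])
  have e₄ : Equivalent V₁ L := stub_arctanUnit_equivalent_lorentz V₁ L hV₁d' (fun x _ => by rw [hV₁i]) hLd (fun x _ => by rw [hLi])
  have e₅ : Equivalent V₂ L := stub_affineEven_equivalent_lorentz V₂ L hV₂d' (fun x _ => by rw [hV₂i]) hLd (fun x _ => by rw [hLi])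
  have e₆ : Equivalent L piRep := stub_lorentzHalfLine_equivalent_disc L piRep hLd (fun x _ => by rw [hLi]) rfl (fun _ _ => rfl)
  -- partial fractions (rule 1b) and `[L] + [L] ∼ [2L]` (rule 1b)
  have m₁ : KZ.of V - KZ.of V₁ - KZ.of V₂ ∈ KZ.integrandAddRel := by
    refine ⟨1, V, V₁, V₂, by rw [hV₁d', hVd'], by rw [hV₂d', hVd'], fun x _ => ?_, rfl⟩
    simp only [Pi.add_apply, hVi, hV₁i, hV₂i]
    have h1 : (1 + (x 0) ^ 2) ≠ 0 := by positivity
    have h2 := (evenDen_pos (x 0)).ne'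
    field_simp
    ring
  have m₂ : KZ.of (L.constMul 2 h2) - KZ.of L - KZ.of L ∈ KZ.integrandAddRel := by
    refine ⟨1, L.constMul 2 h2, L, L, rfl, rfl, fun x _ => ?_, rfl⟩
    simp only [Pi.add_apply, IntegralRep.integrand_constMul]
    ring
  have eV : Equivalent V (L.constMul 2 h2) := by
    show KZ.of V - KZ.of (L.constMul 2 h2) ∈ KZ.relations
    have : KZ.of V - KZ.of (L.constMul 2 h2) = (KZ.of V - KZ.of V₁ - KZ.of V₂) + (KZ.of V₁ - KZ.of L) + (KZ.of V₂ - KZ.of L) -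
        (KZ.of (L.constMul 2 h2) - KZ.of L - KZ.of L) := by abel
    rw [this]
    exact KZ.relations.sub_mem (KZ.relations.add_mem (KZ.relations.add_mem (KZ.integrandAddRel_subset_relations m₁) e₄) e₅)
      (KZ.integrandAddRel_subset_relations m₂)
  exact e₁.symm.trans (e₂.trans (e₃.trans (eV.trans (e₆.constMul 2 h2))))

/-- `sin(π·(1/6)) = 1/2`, the argument written `π · (1/6 : ℚ)`. [folklore] -/
theorem sin_pi_mul_one_sixth : Real.sin (Real.pi * ((1 / 6 : ℚ) : ℝ)) = 1 / 2 := by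
  rw [show Real.pi * ((1 / 6 : ℚ) : ℝ) = Real.pi / 6 by push_cast; ring, Real.sin_pi_div_six]

/-- **The instance `a = 1/6` of `EulerReflectionRational`** (crux stmt-KontsevichZagierPeriods-3383 of route CompiledSubstitutions, VERBATIM shape;
registered anchor `eulerReflectionRational_one_sixth` of crux stmt-3897): `[(0,1), sin(π/6)·x^{-5/6}(1-x)^{-1/6}] ∼ [closed unit disc, 1]` — Euler's
reflection `sin(π/6)Γ(1/6)Γ(5/6) = π` realised by Kontsevich–Zagier moves. [cite: KontsevichZagier2001, §1.2] [cite: AndrewsAskeyRoy1999, Thm 1.2.1] -/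
theorem eulerReflectionRational_one_sixth : ∀ (r : KZ.IntegralRep 1) (p : KZ.IntegralRep 2),
    r.domain = {x | x 0 ∈ Set.Ioo (0:ℝ) 1} →
    Set.EqOn r.integrand (fun x => Real.sin (Real.pi * ((1/6 : ℚ) : ℝ)) * (x 0) ^ (((1/6 : ℚ) : ℝ) - 1) *
      (1 - x 0) ^ (-((1/6 : ℚ) : ℝ))) r.domain →
    p.domain = {z | z 0 ^ 2 + z 1 ^ 2 ≤ 1} → Set.EqOn p.integrand (fun _ => 1) p.domain → KZ.Equivalent r p := by
  intro r p hrd hri hpd hpi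
  have h2 : IsAlgebraic ℚ (2:ℝ) := by simpa using isAlgebraic_nat (R := ℚ) (A := ℝ) 2
  obtain ⟨β, hβd, hβi⟩ := exists_betaRep' (1 / 6) (5 / 6) (by norm_num) (by norm_num)
  have hβi' : EqOn β.integrand (fun x => (x 0) ^ (-(5:ℝ) / 6) * (1 - x 0) ^ (-(1:ℝ) / 6)) β.domain := by
    intro x _
    rw [hβi]
    norm_num
  have e := (betaSixth_equivalent_two_piRep h2 β hβd hβi').constMul ((1:ℝ) / 2) isAlgebraic_one_half
  have hr : Equivalent r (β.constMul ((1:ℝ) / 2) isAlgebraic_one_half) := by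
    refine of_sub_of_mem_relations_of_eqOn (by rw [IntegralRep.domain_constMul, hβd, hrd]) fun x hx => ?_
    have hx' : x ∈ β.domain := by rw [hβd, ← hrd]; exact hx
    simp only [IntegralRep.integrand_constMul]
    rw [hri hx, hβi' hx', sin_pi_mul_one_sixth]
    norm_num
    ring
  have hp : Equivalent ((piRep.constMul 2 h2).constMul ((1:ℝ) / 2) isAlgebraic_one_half) p := by
    refine of_sub_of_mem_relations_of_eqOn (by rw [IntegralRep.domain_constMul, IntegralRep.domain_constMul, hpd]; rfl) fun z hz => ?_
    have hz' : z ∈ p.domain := by rw [hpd]; simpa using hz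
    simp only [IntegralRep.integrand_constMul, piRep_integrand, hpi hz']
    norm_num
  exact hr.trans (e.trans hp)

/-- **The instance `a = 5/6` of `EulerReflectionRational`** (verbatim shape): one more reflection `x ↦ 1 − x` (`KZ.betaReflection_equivalent`);
`sin(5π/6) = sin(π/6)`. [cite: KontsevichZagier2001, §1.2] [cite: AndrewsAskeyRoy1999, Thm 1.2.1] -/
theorem eulerReflectionRational_five_sixths : ∀ (r : KZ.IntegralRep 1) (p : KZ.IntegralRep 2),
    r.domain = {x | x 0 ∈ Set.Ioo (0:ℝ) 1} →
    Set.EqOn r.integrand (fun x => Real.sin (Real.pi * ((5/6 : ℚ) : ℝ)) * (x 0) ^ (((5/6 : ℚ) : ℝ) - 1) *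
      (1 - x 0) ^ (-((5/6 : ℚ) : ℝ))) r.domain →
    p.domain = {z | z 0 ^ 2 + z 1 ^ 2 ≤ 1} → Set.EqOn p.integrand (fun _ => 1) p.domain → KZ.Equivalent r p := by
  intro r p hrd hri hpd hpi
  have hsin : Real.sin (Real.pi * ((5/6 : ℚ) : ℝ)) = 1 / 2 := by
    rw [show Real.pi * ((5 / 6 : ℚ) : ℝ) = Real.pi - Real.pi / 6 by push_cast; ring, Real.sin_pi_sub, Real.sin_pi_div_six]
  obtain ⟨β₁, hβ₁d, hβ₁i⟩ := exists_betaRep' (5 / 6) (1 / 6) (by norm_num) (by norm_num)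
  obtain ⟨β, hβd, hβi⟩ := exists_betaRep' (1 / 6) (5 / 6) (by norm_num) (by norm_num)
  have e₀ : Equivalent β₁ β := by
    refine betaReflection_equivalent (-(1:ℝ) / 6) (-(5:ℝ) / 6) β₁ β hβ₁d (fun x _ => ?_) hβd (fun x _ => ?_)
    · rw [hβ₁i]; norm_num
    · rw [hβi]; norm_num
  have e₁ : Equivalent r (β₁.constMul ((1:ℝ) / 2) isAlgebraic_one_half) := by
    refine of_sub_of_mem_relations_of_eqOn (by rw [IntegralRep.domain_constMul, hβ₁d, hrd]) fun x hx => ?_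
    simp only [IntegralRep.integrand_constMul, hβ₁i]
    rw [hri hx, hsin]
    norm_num
    ring
  have e₂ : Equivalent (β.constMul ((1:ℝ) / 2) isAlgebraic_one_half) p := by
    refine eulerReflectionRational_one_sixth _ p (by rw [IntegralRep.domain_constMul, hβd]) (fun x _ => ?_) hpd hpi
    simp only [IntegralRep.integrand_constMul, hβi, sin_pi_mul_one_sixth]
    norm_num
    ring
  exact e₁.trans ((e₀.constMul ((1:ℝ) / 2) isAlgebraic_one_half).trans e₂)

end Summit.KontsevichZagierPeriods.FermatIsogeny.BetaLinearSector.Sixths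

end
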